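import Literature.Analysis.FluidPDE.AncientSimilarityVorticity
import Literature.Analysis.FluidPDE.VorticityStretching
import Literature.Analysis.FluidPDE.VorticityCalculus
import Literature.Analysis.FluidPDE.WholeSpaceIBP
import HarnessLib

/-!
# The dilution budget of a Leray profile, I: vorticity equation and weighted identities
# (route `HubbleDynamo`, item `DilutionBudget`, stmt-NavierStokesRegularity-1938)

Helper file (all results proved). For a smooth Leray profile
`−νΔU + aU + a(y·∇)U + (U·∇)U + ∇P = 0`, `div U = 0` on `ℝ³` the vorticity `Ω = curl U` obeys the
pointwise vorticity equation `νΔΩ = 2aΩ + a(y·∇)Ω + (U·∇)Ω − (Ω·∇)U`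
(`hubbleDilution_vorticity_eq`: curl of the system, `curl Δ = Δ curl`,
`curl (y·∇)U = Ω + (y·∇)Ω`, `curl (U·∇)U = (U·∇)Ω − (Ω·∇)U`, `curl ∇P = 0`). Tested against `φΩ`
for a `C¹_c` weight `φ` and integrated by parts on the whole space (no boundary terms, tree file
`WholeSpaceIBP`): `∫φ⟪ΔΩ,Ω⟫ = −∫φ|∇Ω|² − Σᵢ∫∂ᵢφ⟪∂ᵢΩ,Ω⟫` (`hubbleDilution_green`),
`2∫φ⟪(y·∇)Ω,Ω⟫ = −3∫φ|Ω|² − ∫(y·∇φ)|Ω|²` (`hubbleDilution_drift`: transport by the diverging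
Hubble flow, `div y = 3`), `2∫φ⟪(U·∇)Ω,Ω⟫ = −∫(U·∇φ)|Ω|²` (`hubbleDilution_convect`). Together:
the truncated dilution budget `hubbleDilution_cutoff_identity`
`∫φ⟪Ω,(Ω·∇)U⟫ = (a/2)∫φ|Ω|² + ν∫φ|∇Ω|² + (cut-off errors)` — the `−2a` of `curl(a y × Ω)` against
`+3a/2` of transport leaves exactly `a/2` of Hubble dilution. The limit `R → ∞` in the Type-I decay
class is taken in `HubbleDynamoDilutionBudget`.

References: Tsai 1998 (ARMA 143), §2; Nečas–Růžička–Šverák 1996, (1.4)–(1.5); Majda–Bertozzi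
(CUP 2002), §1.1 vector identities, §2.4 eq. (2.110).
-/

noncomputable section

set_option linter.dupNamespace false

open MeasureTheory Set Function Filter Topology InnerProductSpace
open scoped RealInnerProductSpace Laplacian ContDiff

namespace Summit.NavierStokesRegularity.NavierStokesRegularity.Theorems

open Literature.Analysis.FluidPDE

/-! ### The vorticity equation of a Leray profile -/

/-- **The vorticity equation of a Leray profile.** For a `C⁴` velocity `U` and `C²` pressure `P`
solving Leray's profile system `−νΔU + aU + a(y·∇)U + (U·∇)U + ∇P = 0`, `div U = 0`, the vorticity
`Ω = curl U` satisfies pointwise `νΔΩ = 2aΩ + a(y·∇)Ω + (U·∇)Ω − (Ω·∇)U` (curl of the system: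
`curl Δ = Δ curl`, `curl (y·∇)U = Ω + (y·∇)Ω`, `curl (U·∇)U = (U·∇)Ω − (Ω·∇)U`, `curl ∇P = 0`). -/
theorem hubbleDilution_vorticity_eq {ν a : ℝ} {U : (EuclideanSpace ℝ (Fin 3)) → (EuclideanSpace ℝ (Fin 3))} {P : (EuclideanSpace ℝ (Fin 3)) → ℝ}
    (hU : ContDiff ℝ 4 U) (hP : ContDiff ℝ 2 P) (h : IsLerayProfile ν a U P) (y : (EuclideanSpace ℝ (Fin 3))) :
    ν • (Δ (curl U)) y =
      (2 * a) • curl U y + a • fderiv ℝ (curl U) y y + fderiv ℝ (curl U) y (U y)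
        - fderiv ℝ U y (curl U y) := by
  have hU3 : ContDiff ℝ 3 U := hU.of_le (by norm_num)
  have hU2 : ContDiff ℝ 2 U := hU.of_le (by norm_num)
  have hU1 : ContDiff ℝ 1 U := hU.of_le (by norm_num)
  -- the profile system solved for the viscous term, as an identity of functions
  have hfun : (fun y => ν • (Δ U) y) =
      fun y => ((a • U y + a • fderiv ℝ U y y) + convect U U y) + gradient P y := by
    funext y
    have e := h.profile_eq y
    calc ν • (Δ U) y
        = ν • (Δ U) y + (-(ν • (Δ U) y) + a • U y + a • fderiv ℝ U y y + convect U U y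
            + gradient P y) := by rw [e, add_zero]
      _ = ((a • U y + a • fderiv ℝ U y y) + convect U U y) + gradient P y := by abel
  -- differentiability of every term at `y`
  have hDU : ContDiff ℝ 3 (fderiv ℝ U) := hU.fderiv_right (m := 3) (by norm_num)
  have hΔ : ContDiff ℝ 1 (Δ U) := contDiff_one_laplacian hU3
  have dΔ : DifferentiableAt ℝ (Δ U) y := (hΔ.differentiable one_ne_zero) y
  have dU : DifferentiableAt ℝ U y := (hU1.differentiable one_ne_zero) y
  have hT : ContDiff ℝ 3 (fun y => fderiv ℝ U y y) := hDU.clm_apply contDiff_id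
  have dT : DifferentiableAt ℝ (fun y => fderiv ℝ U y y) y := (hT.differentiable (by norm_num)) y
  have hconv : ContDiff ℝ 3 (convect U U) := hDU.clm_apply hU3
  have dconv : DifferentiableAt ℝ (convect U U) y := (hconv.differentiable (by norm_num)) y
  have hgrad : ContDiff ℝ 1 (gradient P) := by
    have e : gradient P = fun x => (InnerProductSpace.toDual ℝ (EuclideanSpace ℝ (Fin 3))).symm (fderiv ℝ P x) := rfl
    rw [e]
    exact (InnerProductSpace.toDual ℝ (EuclideanSpace ℝ (Fin 3))).symm.contDiff.comp (hP.fderiv_right (m := 1) (by norm_num))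
  have dgrad : DifferentiableAt ℝ (gradient P) y := (hgrad.differentiable one_ne_zero) y
  have dA : DifferentiableAt ℝ (fun y => a • U y) y := dU.const_smul a
  have dB : DifferentiableAt ℝ (fun y => a • fderiv ℝ U y y) y := dT.const_smul a
  have dAB : DifferentiableAt ℝ (fun y => a • U y + a • fderiv ℝ U y y) y := dA.add dB
  have dABC : DifferentiableAt ℝ (fun y => (a • U y + a • fderiv ℝ U y y) + convect U U y) y :=
    dAB.add dconv
  -- take the curl of both sides
  have key : curl (fun y => ν • (Δ U) y) y =
      curl (fun y => ((a • U y + a • fderiv ℝ U y y) + convect U U y) + gradient P y) y := by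
    rw [hfun]
  rw [curl_const_smul dΔ, curl_laplacian hU3, curl_add dABC dgrad, curl_add dAB dconv,
    curl_add dA dB, curl_const_smul dU, curl_const_smul dT, curl_fderiv_apply_self hU2,
    curl_convect_self_of_isDivFree hU2 h.divFree, curl_gradient_eq_zero_holds P hP] at key
  rw [key]
  simp only [convect_apply]
  module

/-! ### Integration by parts against a compactly supported weight -/

section Weighted

variable {U : (EuclideanSpace ℝ (Fin 3)) → (EuclideanSpace ℝ (Fin 3))} {φ : (EuclideanSpace ℝ (Fin 3)) → ℝ}

/-- A continuous function times a continuous compactly supported weight is integrable. -/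
theorem hubbleDilution_integrable_mul {g : (EuclideanSpace ℝ (Fin 3)) → ℝ} (hφ : Continuous φ)
    (hφs : HasCompactSupport φ) (hg : Continuous g) : Integrable (fun y => φ y * g y) :=
  (hφ.mul hg).integrable_of_hasCompactSupport hφs.mul_right

/-- `y ↦ Dφ(y)[w(y)] g(y)` is integrable for `φ ∈ C¹_c` and continuous `w`, `g`. -/
theorem hubbleDilution_integrable_fderiv_mul {w : (EuclideanSpace ℝ (Fin 3)) → (EuclideanSpace ℝ (Fin 3))} {g : (EuclideanSpace ℝ (Fin 3)) → ℝ} (hφ : ContDiff ℝ 1 φ)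
    (hφs : HasCompactSupport φ) (hw : Continuous w) (hg : Continuous g) :
    Integrable (fun y => fderiv ℝ φ y (w y) * g y) := by
  refine (((hφ.continuous_fderiv one_ne_zero).clm_apply hw).mul hg).integrable_of_hasCompactSupport
    ((hφs.fderiv (𝕜 := ℝ)).mono fun y hy => ?_)
  contrapose! hy
  simp only [mem_support, not_not] at hy
  simp [hy]

/-- **Green's identity, weighted.** For `U ∈ C³` and `φ ∈ C¹_c`:
`∫φ⟪ΔΩ,Ω⟫ + ∫φ|∇Ω|² + Σᵢ∫(∂ᵢφ)⟪∂ᵢΩ,Ω⟫ = 0`, `Ω = curl U` (tree `integral_inner_laplacian_add_eq_zero`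
with the test field `φΩ`). -/
theorem hubbleDilution_green (hU : ContDiff ℝ 3 U) (hφ : ContDiff ℝ 1 φ)
    (hφs : HasCompactSupport φ) :
    (∫ y, φ y * ⟪(Δ (curl U)) y, curl U y⟫)
      + (∫ y, φ y * frobeniusNormSq (fderiv ℝ (curl U) y))
      + ∑ i, ∫ y, fderiv ℝ φ y ((stdOrthonormalBasis ℝ (EuclideanSpace ℝ (Fin 3))) i) * ⟪fderiv ℝ (curl U) y ((stdOrthonormalBasis ℝ (EuclideanSpace ℝ (Fin 3))) i), curl U y⟫ = 0 := by
  have hΩ2 : ContDiff ℝ 2 (curl U) := contDiff_curl (n := 2) (by exact_mod_cast hU)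
  have hΩ1 : ContDiff ℝ 1 (curl U) := hΩ2.of_le one_le_two
  have hw : ContDiff ℝ 1 fun y => φ y • curl U y := hφ.smul hΩ1
  have hc : HasCompactSupport fun y => φ y • curl U y := hφs.smul_right
  have key := integral_inner_laplacian_add_eq_zero (stdOrthonormalBasis ℝ (EuclideanSpace ℝ (Fin 3))) hΩ2 hw (Or.inr hc)
  have cΩ : Continuous (curl U) := continuous_curl (hU.of_le (by norm_num))
  have cDΩ : Continuous (fderiv ℝ (curl U)) := hΩ1.continuous_fderiv one_ne_zero
  -- pointwise forms of the two integrands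
  have e1 : (fun y => ⟪(Δ (curl U)) y, φ y • curl U y⟫) =
      fun y => φ y * ⟪(Δ (curl U)) y, curl U y⟫ := by
    funext y; rw [real_inner_smul_right]
  have e2 : ∀ i, (fun y => ⟪fderiv ℝ (curl U) y ((stdOrthonormalBasis ℝ (EuclideanSpace ℝ (Fin 3))) i), fderiv ℝ (fun y => φ y • curl U y) y ((stdOrthonormalBasis ℝ (EuclideanSpace ℝ (Fin 3))) i)⟫) =
      fun y => φ y * ‖fderiv ℝ (curl U) y ((stdOrthonormalBasis ℝ (EuclideanSpace ℝ (Fin 3))) i)‖ ^ 2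
        + fderiv ℝ φ y ((stdOrthonormalBasis ℝ (EuclideanSpace ℝ (Fin 3))) i) * ⟪fderiv ℝ (curl U) y ((stdOrthonormalBasis ℝ (EuclideanSpace ℝ (Fin 3))) i), curl U y⟫ := by
    intro i; funext y
    rw [fderiv_fun_smul (hφ.differentiable one_ne_zero y) (hΩ1.differentiable one_ne_zero y)]
    simp only [add_apply, smul_apply, ContinuousLinearMap.smulRight_apply, inner_add_right, real_inner_smul_right,
      real_inner_self_eq_norm_sq]
  rw [e1] at key
  simp only [e2] at key
  have hi1 : ∀ i, Integrable (fun y => φ y * ‖fderiv ℝ (curl U) y ((stdOrthonormalBasis ℝ (EuclideanSpace ℝ (Fin 3))) i)‖ ^ 2) := fun i =>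
    hubbleDilution_integrable_mul hφ.continuous hφs ((cDΩ.clm_apply continuous_const).norm.pow 2)
  have hi2 : ∀ i, Integrable
      (fun y => fderiv ℝ φ y ((stdOrthonormalBasis ℝ (EuclideanSpace ℝ (Fin 3))) i) * ⟪fderiv ℝ (curl U) y ((stdOrthonormalBasis ℝ (EuclideanSpace ℝ (Fin 3))) i), curl U y⟫) := fun i =>
    hubbleDilution_integrable_fderiv_mul hφ hφs continuous_const
      ((cDΩ.clm_apply continuous_const).inner cΩ)
  have hsplit : ∑ i, ∫ y, (φ y * ‖fderiv ℝ (curl U) y ((stdOrthonormalBasis ℝ (EuclideanSpace ℝ (Fin 3))) i)‖ ^ 2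
      + fderiv ℝ φ y ((stdOrthonormalBasis ℝ (EuclideanSpace ℝ (Fin 3))) i) * ⟪fderiv ℝ (curl U) y ((stdOrthonormalBasis ℝ (EuclideanSpace ℝ (Fin 3))) i), curl U y⟫) =
      (∑ i, ∫ y, φ y * ‖fderiv ℝ (curl U) y ((stdOrthonormalBasis ℝ (EuclideanSpace ℝ (Fin 3))) i)‖ ^ 2)
        + ∑ i, ∫ y, fderiv ℝ φ y ((stdOrthonormalBasis ℝ (EuclideanSpace ℝ (Fin 3))) i) * ⟪fderiv ℝ (curl U) y ((stdOrthonormalBasis ℝ (EuclideanSpace ℝ (Fin 3))) i), curl U y⟫ := by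
    rw [← Finset.sum_add_distrib]
    exact Finset.sum_congr rfl fun i _ => integral_add (hi1 i) (hi2 i)
  have hfrob : ∑ i, ∫ y, φ y * ‖fderiv ℝ (curl U) y ((stdOrthonormalBasis ℝ (EuclideanSpace ℝ (Fin 3))) i)‖ ^ 2 =
      ∫ y, φ y * frobeniusNormSq (fderiv ℝ (curl U) y) := by
    rw [← integral_finsetSum _ fun i _ => hi1 i]
    refine integral_congr_ae (Eventually.of_forall fun y => ?_)
    simp only [frobeniusNormSq, Finset.mul_sum]
  rw [hsplit, hfrob] at key
  linarith

/-- The divergence of the identity field on `ℝ³` is `3`. -/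
theorem hubbleDilution_divergence_id (y : (EuclideanSpace ℝ (Fin 3))) :
    VectorCalculus.divergence (fun y : (EuclideanSpace ℝ (Fin 3)) => y) y = 3 := by
  rw [VectorCalculus.divergence, fderiv_fun_id,
    show (((ContinuousLinearMap.id ℝ (EuclideanSpace ℝ (Fin 3)) : (EuclideanSpace ℝ (Fin 3)) →L[ℝ] (EuclideanSpace ℝ (Fin 3)))) : (EuclideanSpace ℝ (Fin 3)) →ₗ[ℝ] (EuclideanSpace ℝ (Fin 3))) = LinearMap.id from rfl,
    LinearMap.trace_id, finrank_euclideanSpace, Fintype.card_fin]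
  norm_num

/-- **The Leray drift term, weighted.** For `U ∈ C²` and `φ ∈ C¹_c`:
`2∫φ⟪(y·∇)Ω,Ω⟫ + ∫(y·∇φ)|Ω|² + 3∫φ|Ω|² = 0` (trilinear identity with the wind `y ↦ y`,
`div y = 3`: transport by the diverging Hubble flow). -/
theorem hubbleDilution_drift (hU : ContDiff ℝ 2 U) (hφ : ContDiff ℝ 1 φ)
    (hφs : HasCompactSupport φ) :
    2 * (∫ y, φ y * ⟪fderiv ℝ (curl U) y y, curl U y⟫)
      + (∫ y, fderiv ℝ φ y y * ‖curl U y‖ ^ 2) + 3 * ∫ y, φ y * ‖curl U y‖ ^ 2 = 0 := by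
  have hΩ1 : ContDiff ℝ 1 (curl U) := contDiff_curl (n := 1) (by exact_mod_cast hU)
  have hw : ContDiff ℝ 1 fun y => φ y • curl U y := hφ.smul hΩ1
  have hc : HasCompactSupport fun y => φ y • curl U y := hφs.smul_right
  have key := integral_inner_convect_add_eq_zero (u := fun y : (EuclideanSpace ℝ (Fin 3)) => y) (v := curl U)
    (w := fun y => φ y • curl U y) contDiff_id hΩ1 hw hc
  have cΩ : Continuous (curl U) := continuous_curl (hU.of_le (by norm_num))
  have cDΩ : Continuous (fderiv ℝ (curl U)) := hΩ1.continuous_fderiv one_ne_zero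
  have e1 : (fun y => ⟪convect (fun y : (EuclideanSpace ℝ (Fin 3)) => y) (curl U) y, φ y • curl U y⟫) =
      fun y => φ y * ⟪fderiv ℝ (curl U) y y, curl U y⟫ := by
    funext y; rw [convect_apply, real_inner_smul_right]
  have e2 : (fun y => ⟪curl U y, convect (fun y : (EuclideanSpace ℝ (Fin 3)) => y) (fun y => φ y • curl U y) y⟫) =
      fun y => φ y * ⟪fderiv ℝ (curl U) y y, curl U y⟫ + fderiv ℝ φ y y * ‖curl U y‖ ^ 2 := by
    funext y
    rw [convect_apply,
      fderiv_fun_smul (hφ.differentiable one_ne_zero y) (hΩ1.differentiable one_ne_zero y)]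
    simp only [add_apply, smul_apply, ContinuousLinearMap.smulRight_apply, inner_add_right, real_inner_smul_right,
      real_inner_self_eq_norm_sq]
    rw [real_inner_comm (fderiv ℝ (curl U) y y) (curl U y)]
  have e3 : (fun y => VectorCalculus.divergence (fun y : (EuclideanSpace ℝ (Fin 3)) => y) y * ⟪curl U y, φ y • curl U y⟫) =
      fun y => 3 * (φ y * ‖curl U y‖ ^ 2) := by
    funext y
    rw [hubbleDilution_divergence_id, real_inner_smul_right, real_inner_self_eq_norm_sq]
  rw [e1, e2, e3] at key
  have hiA : Integrable (fun y => φ y * ⟪fderiv ℝ (curl U) y y, curl U y⟫) :=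
    hubbleDilution_integrable_mul hφ.continuous hφs ((cDΩ.clm_apply continuous_id).inner cΩ)
  have hiB : Integrable (fun y => fderiv ℝ φ y y * ‖curl U y‖ ^ 2) :=
    hubbleDilution_integrable_fderiv_mul hφ hφs continuous_id (cΩ.norm.pow 2)
  rw [integral_add hiA hiB, integral_const_mul] at key
  linarith

/-- **The convection term, weighted.** For a divergence-free `U ∈ C²` and `φ ∈ C¹_c`:
`2∫φ⟪(U·∇)Ω,Ω⟫ + ∫(U·∇φ)|Ω|² = 0` (trilinear identity with the wind `U`, `div U = 0`). -/
theorem hubbleDilution_convect (hU : ContDiff ℝ 2 U) (hdiv : VectorCalculus.IsDivFree U)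
    (hφ : ContDiff ℝ 1 φ) (hφs : HasCompactSupport φ) :
    2 * (∫ y, φ y * ⟪fderiv ℝ (curl U) y (U y), curl U y⟫)
      + ∫ y, fderiv ℝ φ y (U y) * ‖curl U y‖ ^ 2 = 0 := by
  have hU1 : ContDiff ℝ 1 U := hU.of_le (by norm_num)
  have hΩ1 : ContDiff ℝ 1 (curl U) := contDiff_curl (n := 1) (by exact_mod_cast hU)
  have hw : ContDiff ℝ 1 fun y => φ y • curl U y := hφ.smul hΩ1
  have hc : HasCompactSupport fun y => φ y • curl U y := hφs.smul_right
  have key := integral_inner_convect_add_eq_zero (u := U) (v := curl U)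
    (w := fun y => φ y • curl U y) hU1 hΩ1 hw hc
  have cΩ : Continuous (curl U) := continuous_curl hU1
  have cDΩ : Continuous (fderiv ℝ (curl U)) := hΩ1.continuous_fderiv one_ne_zero
  have e1 : (fun y => ⟪convect U (curl U) y, φ y • curl U y⟫) =
      fun y => φ y * ⟪fderiv ℝ (curl U) y (U y), curl U y⟫ := by
    funext y; rw [convect_apply, real_inner_smul_right]
  have e2 : (fun y => ⟪curl U y, convect U (fun y => φ y • curl U y) y⟫) =
      fun y => φ y * ⟪fderiv ℝ (curl U) y (U y), curl U y⟫
        + fderiv ℝ φ y (U y) * ‖curl U y‖ ^ 2 := by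
    funext y
    rw [convect_apply,
      fderiv_fun_smul (hφ.differentiable one_ne_zero y) (hΩ1.differentiable one_ne_zero y)]
    simp only [add_apply, smul_apply, ContinuousLinearMap.smulRight_apply, inner_add_right, real_inner_smul_right,
      real_inner_self_eq_norm_sq]
    rw [real_inner_comm (fderiv ℝ (curl U) y (U y)) (curl U y)]
  have e3 : (fun y => VectorCalculus.divergence U y * ⟪curl U y, φ y • curl U y⟫) =
      fun y => (0 : ℝ) := by
    funext y; rw [hdiv y, zero_mul]
  rw [e1, e2, e3, integral_zero, add_zero] at key
  have hiA : Integrable (fun y => φ y * ⟪fderiv ℝ (curl U) y (U y), curl U y⟫) :=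
    hubbleDilution_integrable_mul hφ.continuous hφs ((cDΩ.clm_apply hU1.continuous).inner cΩ)
  have hiB : Integrable (fun y => fderiv ℝ φ y (U y) * ‖curl U y‖ ^ 2) :=
    hubbleDilution_integrable_fderiv_mul hφ hφs hU1.continuous (cΩ.norm.pow 2)
  rw [integral_add hiA hiB] at key
  linarith

/-- **The vorticity equation tested against `φΩ`.** For a Leray profile with `U ∈ C⁴`, `P ∈ C²`
and a continuous compactly supported weight `φ`:
`ν∫φ⟪ΔΩ,Ω⟫ = 2a∫φ|Ω|² + a∫φ⟪(y·∇)Ω,Ω⟫ + ∫φ⟪(U·∇)Ω,Ω⟫ − ∫φ⟪Ω,(Ω·∇)U⟫`. -/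
theorem hubbleDilution_tested {ν a : ℝ} {P : (EuclideanSpace ℝ (Fin 3)) → ℝ} (hU : ContDiff ℝ 4 U) (hP : ContDiff ℝ 2 P)
    (h : IsLerayProfile ν a U P) (hφ : Continuous φ) (hφs : HasCompactSupport φ) :
    ν * ∫ y, φ y * ⟪(Δ (curl U)) y, curl U y⟫ =
      2 * a * (∫ y, φ y * ‖curl U y‖ ^ 2)
        + a * (∫ y, φ y * ⟪fderiv ℝ (curl U) y y, curl U y⟫)
        + (∫ y, φ y * ⟪fderiv ℝ (curl U) y (U y), curl U y⟫)
        - ∫ y, φ y * ⟪curl U y, fderiv ℝ U y (curl U y)⟫ := by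
  have hU3 : ContDiff ℝ 3 U := hU.of_le (by norm_num)
  have hU1 : ContDiff ℝ 1 U := hU.of_le (by norm_num)
  have hΩ2 : ContDiff ℝ 2 (curl U) := contDiff_curl (n := 2) (by exact_mod_cast hU3)
  have hΩ1 : ContDiff ℝ 1 (curl U) := hΩ2.of_le one_le_two
  have cΩ : Continuous (curl U) := continuous_curl hU1
  have cDΩ : Continuous (fderiv ℝ (curl U)) := hΩ1.continuous_fderiv one_ne_zero
  have cDU : Continuous (fderiv ℝ U) := hU1.continuous_fderiv one_ne_zero
  have cΔ : Continuous (Δ (curl U)) := continuous_laplacian hΩ2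
  have hpt : ∀ y, ν * (φ y * ⟪(Δ (curl U)) y, curl U y⟫) =
      2 * a * (φ y * ‖curl U y‖ ^ 2) + a * (φ y * ⟪fderiv ℝ (curl U) y y, curl U y⟫)
        + φ y * ⟪fderiv ℝ (curl U) y (U y), curl U y⟫
        - φ y * ⟪curl U y, fderiv ℝ U y (curl U y)⟫ := by
    intro y
    have e := congrArg (fun v => φ y * ⟪v, curl U y⟫) (hubbleDilution_vorticity_eq hU hP h y)
    simp only [inner_add_left, inner_sub_left, real_inner_smul_left,
      real_inner_self_eq_norm_sq] at e
    rw [real_inner_comm (curl U y) (fderiv ℝ U y (curl U y))] at e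
    linear_combination e
  have iL : Integrable (fun y => φ y * ⟪(Δ (curl U)) y, curl U y⟫) :=
    hubbleDilution_integrable_mul hφ hφs (cΔ.inner cΩ)
  have i1 : Integrable (fun y => φ y * ‖curl U y‖ ^ 2) :=
    hubbleDilution_integrable_mul hφ hφs (cΩ.norm.pow 2)
  have i2 : Integrable (fun y => φ y * ⟪fderiv ℝ (curl U) y y, curl U y⟫) :=
    hubbleDilution_integrable_mul hφ hφs ((cDΩ.clm_apply continuous_id).inner cΩ)
  have i3 : Integrable (fun y => φ y * ⟪fderiv ℝ (curl U) y (U y), curl U y⟫) :=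
    hubbleDilution_integrable_mul hφ hφs ((cDΩ.clm_apply hU1.continuous).inner cΩ)
  have i4 : Integrable (fun y => φ y * ⟪curl U y, fderiv ℝ U y (curl U y)⟫) :=
    hubbleDilution_integrable_mul hφ hφs (cΩ.inner (cDU.clm_apply cΩ))
  have hint : ∫ y, ν * (φ y * ⟪(Δ (curl U)) y, curl U y⟫) =
      ∫ y, (2 * a * (φ y * ‖curl U y‖ ^ 2) + a * (φ y * ⟪fderiv ℝ (curl U) y y, curl U y⟫)
          + φ y * ⟪fderiv ℝ (curl U) y (U y), curl U y⟫
          - φ y * ⟪curl U y, fderiv ℝ U y (curl U y)⟫) :=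
    integral_congr_ae (Eventually.of_forall hpt)
  have s0 : ∫ y, ν * (φ y * ⟪(Δ (curl U)) y, curl U y⟫) = ν * ∫ y, φ y * ⟪(Δ (curl U)) y, curl U y⟫ :=
    integral_const_mul _ _
  have s1 : ∫ y, (2 * a * (φ y * ‖curl U y‖ ^ 2) + a * (φ y * ⟪fderiv ℝ (curl U) y y, curl U y⟫)
          + φ y * ⟪fderiv ℝ (curl U) y (U y), curl U y⟫
          - φ y * ⟪curl U y, fderiv ℝ U y (curl U y)⟫) =
      (∫ y, (2 * a * (φ y * ‖curl U y‖ ^ 2) + a * (φ y * ⟪fderiv ℝ (curl U) y y, curl U y⟫)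
          + φ y * ⟪fderiv ℝ (curl U) y (U y), curl U y⟫))
        - ∫ y, φ y * ⟪curl U y, fderiv ℝ U y (curl U y)⟫ :=
    integral_sub (((i1.const_mul _).add (i2.const_mul _)).add i3) i4
  have s2 : ∫ y, (2 * a * (φ y * ‖curl U y‖ ^ 2) + a * (φ y * ⟪fderiv ℝ (curl U) y y, curl U y⟫)
          + φ y * ⟪fderiv ℝ (curl U) y (U y), curl U y⟫) =
      (∫ y, (2 * a * (φ y * ‖curl U y‖ ^ 2) + a * (φ y * ⟪fderiv ℝ (curl U) y y, curl U y⟫)))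
        + ∫ y, φ y * ⟪fderiv ℝ (curl U) y (U y), curl U y⟫ :=
    integral_add ((i1.const_mul _).add (i2.const_mul _)) i3
  have s3 : ∫ y, (2 * a * (φ y * ‖curl U y‖ ^ 2) + a * (φ y * ⟪fderiv ℝ (curl U) y y, curl U y⟫)) =
      (∫ y, 2 * a * (φ y * ‖curl U y‖ ^ 2)) + ∫ y, a * (φ y * ⟪fderiv ℝ (curl U) y y, curl U y⟫) :=
    integral_add (i1.const_mul _) (i2.const_mul _)
  have s4 : ∫ y, 2 * a * (φ y * ‖curl U y‖ ^ 2) = 2 * a * ∫ y, φ y * ‖curl U y‖ ^ 2 :=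
    integral_const_mul _ _
  have s5 : ∫ y, a * (φ y * ⟪fderiv ℝ (curl U) y y, curl U y⟫) =
      a * ∫ y, φ y * ⟪fderiv ℝ (curl U) y y, curl U y⟫ :=
    integral_const_mul _ _
  linarith [hint, s0, s1, s2, s3, s4, s5]

/-- **The truncated dilution budget.** For a Leray profile with `U ∈ C⁴`, `P ∈ C²` and a weight
`φ ∈ C¹_c(ℝ³)`:
`∫φ⟪Ω,(Ω·∇)U⟫ = (a/2)∫φ|Ω|² + ν∫φ|∇Ω|² + (νΣᵢ∫∂ᵢφ⟪∂ᵢΩ,Ω⟫ − (a/2)∫(y·∇φ)|Ω|² − ½∫(U·∇φ)|Ω|²)`;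
the bracket collects the cut-off errors. -/
theorem hubbleDilution_cutoff_identity {ν a : ℝ} {P : (EuclideanSpace ℝ (Fin 3)) → ℝ} (hU : ContDiff ℝ 4 U)
    (hP : ContDiff ℝ 2 P) (h : IsLerayProfile ν a U P) (hφ : ContDiff ℝ 1 φ)
    (hφs : HasCompactSupport φ) :
    ∫ y, φ y * ⟪curl U y, fderiv ℝ U y (curl U y)⟫ =
      a / 2 * (∫ y, φ y * ‖curl U y‖ ^ 2)
        + ν * (∫ y, φ y * frobeniusNormSq (fderiv ℝ (curl U) y))
        + (ν * (∑ i, ∫ y, fderiv ℝ φ y ((stdOrthonormalBasis ℝ (EuclideanSpace ℝ (Fin 3))) i) * ⟪fderiv ℝ (curl U) y ((stdOrthonormalBasis ℝ (EuclideanSpace ℝ (Fin 3))) i), curl U y⟫)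
            - a / 2 * (∫ y, fderiv ℝ φ y y * ‖curl U y‖ ^ 2)
            - 1 / 2 * ∫ y, fderiv ℝ φ y (U y) * ‖curl U y‖ ^ 2) := by
  have hU3 : ContDiff ℝ 3 U := hU.of_le (by norm_num)
  have hU2 : ContDiff ℝ 2 U := hU.of_le (by norm_num)
  have hG := hubbleDilution_green hU3 hφ hφs
  have hT1 := hubbleDilution_drift hU2 hφ hφs
  have hT2 := hubbleDilution_convect hU2 h.divFree hφ hφs
  have hV := hubbleDilution_tested hU hP h hφ.continuous hφs
  linear_combination hV - ν * hG + (a / 2) * hT1 + (1 / 2) * hT2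

end Weighted

end Summit.NavierStokesRegularity.NavierStokesRegularity.Theorems

end
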